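import Summits.CriticalPhenomena.PercolationContinuityZ3.Theses.PercNearOneGluing
import HarnessLib

/-!
# Sketch (crux-ideate round 2, ideator 5) — crux `PercNearOneGluing.NearOneGluing` (stmt-CriticalPhenomena-4574)

Typed statements over existing declarations (`prodBernoulli`, `openConn`, `openConnIn`), `lean check` rc 0,
0 sorries.  One finite weighted graph: vertices `Fin n`, weights `w`, `μ_w = prodBernoulli w`; relay set `A`,
source `o`, target `b`.

§1 (card `live-fraction-laplace`): the relay-free POCKET of `o`, the finger identity and the dead-finger bound.
§2 (Negative-notes `maximum-principles`): the conditional-deadness / conditional-badness FIELDS `β`, `κ` and their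
   one-step maximum principles — REFUTED this session by exact rational witnesses on 6 vertices (see the docstrings);
   kept typed because the GLOBAL statements `BetaGluing` / `ConditionalAdditiveGluing` (between Kozma–Nitzan's
   Conjectures 2 and 1) are unrefuted and are natural refuter targets.
-/

namespace Summit.CriticalPhenomena.PercolationContinuityZ3.Cruxes.NearOneGluing.SketchR2I5

open MeasureTheory
open scoped Classical BigOperators
open Literature.Probability.LatticeModels (prodBernoulli)
open Literature.Probability.Percolation (openConn openConnIn)

noncomputable section

/-! ## §0 Notation -/

/-- `{x ↔ A}`. -/
def reachEv {n : ℕ} (A : Finset (Fin n)) (x : Fin n) : Set (Set (Sym2 (Fin n))) :=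
  ⋃ a ∈ A, openConn x a

/-- Bad event of the source `x`: `x ↔ A` and `x ↮ b`. -/
def badEv {n : ℕ} (A : Finset (Fin n)) (b x : Fin n) : Set (Set (Sym2 (Fin n))) :=
  reachEv A x ∩ (openConn x b)ᶜ

/-- Active event of the source `x`: `x ↔ A ∪ {b}`. -/
def actEv {n : ℕ} (A : Finset (Fin n)) (b x : Fin n) : Set (Set (Sym2 (Fin n))) :=
  reachEv A x ∪ openConn x b

/-- Weights of `G ∖ S`: every pair meeting the vertex set `S` gets weight `0`. -/
def delSet {n : ℕ} (w : Sym2 (Fin n) → unitInterval) (S : Finset (Fin n)) : Sym2 (Fin n) → unitInterval :=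
  fun e => if ∃ x ∈ S, x ∈ e then 0 else w e

/-- Weights of `G − o`. -/
def delStar {n : ℕ} (w : Sym2 (Fin n) → unitInterval) (o : Fin n) : Sym2 (Fin n) → unitInterval :=
  delSet w {o}

/-- The event "the relay-free pocket of `o` is exactly `S₀`": `{v | o ↔ v inside V ∖ A} = S₀`
(the lead's `pocketBound` notation, Theorems/PercNearOneGluingNearOneGluingPocketBound.lean). -/
def pocketEv {n : ℕ} (A S₀ : Finset (Fin n)) (o : Fin n) : Set (Set (Sym2 (Fin n))) :=
  {ω | ∀ v : Fin n, ω ∈ openConnIn ((↑A : Set (Fin n))ᶜ) o v ↔ v ∈ S₀}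

/-- `q_a(S₀) = ∏_{x ∈ S₀} (1 − w(x,a))`: the probability that the relay `a` is NOT attached to the pocket `S₀`
by an open pocket-to-relay pair (these pairs are independent of the pocket event and of `G ∖ S₀`). -/
def notAttached {n : ℕ} (w : Sym2 (Fin n) → unitInterval) (S₀ : Finset (Fin n)) (a : Fin n) : ℝ :=
  ∏ x ∈ S₀, (1 - (w s(x, a) : ℝ))

/-! ## §1 The finger identity and the dead-finger bound (card `live-fraction-laplace`) -/

/-- **FINGER IDENTITY** (FIRST LEMMA; exact, provable now from the star/pocket independence already formalised in
`pocketBound` and `freshPocketAveraging`).  Partition the bad event by the pocket `S₀` (`o ∈ S₀`, `S₀ ∩ A = ∅`, `b ∉ S₀`);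
given the pocket, the pocket-to-relay pairs are fresh and the world outside is percolation on `G ∖ S₀`; `o ↔ b` iff some
ATTACHED relay is LIVE in `G ∖ S₀` (`a ↔ b` there).  Hence
`μ(o ↔ A, o ↮ b) = Σ_{S₀} μ(pocket = S₀) · ( E_{G∖S₀}[ ∏_{a live} q_a(S₀) ] − ∏_{a ∈ A} q_a(S₀) )`
— the bad probability is the pocket-law average of a LAPLACE TRANSFORM OF THE LIVE ATTACHMENT WEIGHT minus the
no-attachment term.  No entropy: `μ(pocket = ·)` is a probability distribution.  The same computation gives
`μ(o ↮ A) = Σ_{all pockets S₀ (b allowed)} μ(pocket = S₀) · ∏_{a∈A} q_a(S₀)`.  Both identities and the dead-finger bound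
below are exact-checked on 267 357 random instances (compute/finger_check.py, rational arithmetic). -/
def FingerIdentity : Prop :=
  ∀ (n : ℕ) (w : Sym2 (Fin n) → unitInterval) (A : Finset (Fin n)) (o b : Fin n), o ∉ A → o ≠ b →
    (prodBernoulli w).real (badEv A b o) =
      ∑ S₀ ∈ (Finset.univ : Finset (Finset (Fin n))).filter (fun S₀ => o ∈ S₀ ∧ b ∉ S₀ ∧ Disjoint S₀ A),
        (prodBernoulli w).real (pocketEv A S₀ o) *
          ((∫ ω', (∏ a ∈ A, (if ω' ∈ openConn a b then notAttached w S₀ a else (1 : ℝ)))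
              ∂(prodBernoulli (delSet w S₀))) -
            ∏ a ∈ A, notAttached w S₀ a)

/-- **DEAD-FINGER BOUND** (P1, provable now from the finger identity: `∏_{live} q (1 − ∏_{dead} q) ≤ Σ_{dead}(1 − q)`):
`μ(o ↔ A, o ↮ b) ≤ Σ_{S₀} μ(pocket = S₀) · min(1, Σ_{a∈A} (1 − q_a(S₀)) · μ_{G∖S₀}(a ↮ b))` — the pocket-law
AVERAGE of the expected number of attached-and-dead relays, deadness measured in the pocket-depleted graph.  It
replaces the lead's "ghost-boundary reliability" max over adjacent relays by an attachment-weighted sum and carries no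
per-shape entropy factor (contrast `pocketBound`'s `Σ_{S₀} min(μ(pocket = S₀), t·μ(S₀ spanned))`). -/
def DeadFingerBound : Prop :=
  ∀ (n : ℕ) (w : Sym2 (Fin n) → unitInterval) (A : Finset (Fin n)) (o b : Fin n), o ∉ A → o ≠ b →
    (prodBernoulli w).real (badEv A b o) ≤
      ∑ S₀ ∈ (Finset.univ : Finset (Finset (Fin n))).filter (fun S₀ => o ∈ S₀ ∧ b ∉ S₀ ∧ Disjoint S₀ A),
        (prodBernoulli w).real (pocketEv A S₀ o) *
          min 1 (∑ a ∈ A, (1 - notAttached w S₀ a) * (prodBernoulli (delSet w S₀)).real (openConn a b)ᶜ)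

/-- **LIVE-FRACTION CONCENTRATION** (K2 of the card, OPEN — the bet): under the crux hypotheses the live attachment
weight of the pocket is rarely small: for every `c > 0`, the pocket-law average of
`μ_{G∖S₀}( Σ_{a live} (−log q_a(S₀)) ≤ c · Σ_{a∈A} (−log q_a(S₀)) )` tends to `0` with `δ`.  With the finger identity and
`E[e^{−cΛ}] ≤ δ^c` (Hölder on `μ(o ↮ A) = E[e^{−Λ}] ≤ δ`) it gives `μ(bad) ≤ δ^c + o(1)`, i.e. the crux.  Stated in the
division-free "live weight small ⇒ rare" form. -/
def LiveFractionConcentration : Prop :=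
  ∀ ε : ℝ, 0 < ε → ∀ c : ℝ, 0 < c → c < 1 → ∃ δ : ℝ, 0 < δ ∧
    ∀ (n : ℕ) (w : Sym2 (Fin n) → unitInterval) (A : Finset (Fin n)) (o b : Fin n), o ∉ A → o ≠ b →
      (prodBernoulli w).real (reachEv A o)ᶜ ≤ δ →
      (∀ a ∈ A, (prodBernoulli w).real (openConn a b)ᶜ ≤ δ) →
      ∑ S₀ ∈ (Finset.univ : Finset (Finset (Fin n))).filter (fun S₀ => o ∈ S₀ ∧ b ∉ S₀ ∧ Disjoint S₀ A),
        (prodBernoulli w).real (pocketEv A S₀ o) *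
          (prodBernoulli (delSet w S₀)).real
            {ω' | ∑ a ∈ A.filter (fun a => ω' ∈ openConn a b), (-Real.log (notAttached w S₀ a)) ≤
                c * ∑ a ∈ A, (-Real.log (notAttached w S₀ a))} ≤ ε

/-! ## §2 Fields and maximum principles (REFUTED — see Negative-notes/maximum-principles.md) -/

/-- (Mβ) one-step maximum principle for conditional deadness `β(x) = μ(x ↮ b | x ↔ A)`, deletion form.
**REFUTED** (exact): n = 6, w(0,1)=1/2, w(0,2)=1/10, w(0,3)=9/10, w(0,5)=1/10, w(1,2)=9/10, w(1,4)=9/10, w(1,5)=9/10,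
w(2,3)=1/10, w(2,5)=1/2, w(4,5)=1/10, A = {1}, b = 4, o = 3: β_G(o) = 10403532/115067269 exceeds
max(β_{G−o}(0), β_{G−o}(2)) by the factor 1.0000059 (same-graph form: 1.00000043).  Kept as a refuter target /
documentation of the normalisation. -/
def BetaMaxPrinciple : Prop :=
  ∀ (n : ℕ) (w : Sym2 (Fin n) → unitInterval) (A : Finset (Fin n)) (o b : Fin n),
    o ∉ A → o ≠ b →
    (prodBernoulli w).real (badEv A b o) = 0 ∨
    ∃ y : Fin n, y ≠ o ∧ 0 < (w s(o, y) : ℝ) ∧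
      (prodBernoulli w).real (badEv A b o) * (prodBernoulli (delStar w o)).real (reachEv A y) ≤
        (prodBernoulli (delStar w o)).real (badEv A b y) * (prodBernoulli w).real (reachEv A o)

/-- (Mβ-G) same-graph form — **REFUTED** by the same witness (ratio 1.00000043). -/
def BetaMaxPrincipleSameGraph : Prop :=
  ∀ (n : ℕ) (w : Sym2 (Fin n) → unitInterval) (A : Finset (Fin n)) (o b : Fin n),
    o ∉ A → o ≠ b →
    (prodBernoulli w).real (badEv A b o) = 0 ∨
    ∃ y : Fin n, y ≠ o ∧ 0 < (w s(o, y) : ℝ) ∧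
      (prodBernoulli w).real (badEv A b o) * (prodBernoulli w).real (reachEv A y) ≤
        (prodBernoulli w).real (badEv A b y) * (prodBernoulli w).real (reachEv A o)

/-- (SetTransport) the EXACT set-valued replacement (provable now, a mediant identity over the attached set `T` of
`o`): `β_G(o) ≤ max_{∅ ≠ T ⊆ N(o)} β_{(G−o)/T}(T̂)`, stated for the bad/reach numerators and denominators of the merged
set `T` (merging = `T ↔ ·` as a set in `G − o`).  Division-free: either `o` is never bad or some nonempty `T` of
positive-weight neighbours is, as a merged set in `G − o`, conditionally at least as dead. -/
def SetTransport : Prop :=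
  ∀ (n : ℕ) (w : Sym2 (Fin n) → unitInterval) (A : Finset (Fin n)) (o b : Fin n),
    o ∉ A → o ≠ b →
    (prodBernoulli w).real (badEv A b o) = 0 ∨
    ∃ T : Finset (Fin n), T.Nonempty ∧ o ∉ T ∧ (∀ y ∈ T, 0 < (w s(o, y) : ℝ)) ∧
      (prodBernoulli w).real (badEv A b o) *
          (prodBernoulli (delStar w o)).real (⋃ y ∈ T, reachEv A y) ≤
        (prodBernoulli (delStar w o)).real ((⋃ y ∈ T, reachEv A y) ∩ (⋃ y ∈ T, openConn y b)ᶜ) *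
          (prodBernoulli w).real (reachEv A o)

/-- **(BetaGluing)** — UNREFUTED global statement (0 violations in ≈ 3·10⁶ exact instances, n ≤ 7):
`μ(x ↔ A, x ↮ b) ≤ max_a μ(a ↮ b) · μ(x ↔ A)` for every vertex `x`.  Kozma–Nitzan Conj. 2 ⇒ BetaGluing ⇒ Conj. 1 ⇒
`AdditiveGluing` ⇒ the crux.  Recorded as a refuter target; this session found NO local mechanism for it
(strict interior local maxima of `β` exist, e.g. `o = 3` in the witness above). -/
def BetaGluing : Prop :=
  ∀ (n : ℕ) (w : Sym2 (Fin n) → unitInterval) (A : Finset (Fin n)) (x b : Fin n) (t : ℝ), 0 ≤ t →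
    (∀ a ∈ A, (prodBernoulli w).real (openConn a b)ᶜ ≤ t) →
    (prodBernoulli w).real (badEv A b x) ≤ t * (prodBernoulli w).real (reachEv A x)

/-- **(CAG)** = Kozma–Nitzan Conjecture 1 with `b` adjoined to the relay set (unrefuted; BetaGluing ⇒ CAG). -/
def ConditionalAdditiveGluing : Prop :=
  ∀ (n : ℕ) (w : Sym2 (Fin n) → unitInterval) (A : Finset (Fin n)) (x b : Fin n) (t : ℝ), 0 ≤ t →
    (∀ a ∈ A, (prodBernoulli w).real (openConn a b)ᶜ ≤ t) →
    (prodBernoulli w).real (badEv A b x) ≤ t * (prodBernoulli w).real (actEv A b x)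

/-- Shape of the `live-fraction-laplace` line: FingerIdentity → LiveFractionConcentration → crux, and the standing
glue CAG → `AdditiveGluing` → `NearOneGluing` for the §2 targets. -/
def LineShape : Prop :=
  (FingerIdentity → LiveFractionConcentration →
      Summit.CriticalPhenomena.PercolationContinuityZ3.Theses.PercNearOneGluing.NearOneGluing) ∧
    (BetaGluing → ConditionalAdditiveGluing) ∧
    (ConditionalAdditiveGluing →
      Summit.CriticalPhenomena.PercolationContinuityZ3.Theses.PercNearOneGluing.AdditiveGluing)

end

end Summit.CriticalPhenomena.PercolationContinuityZ3.Cruxes.NearOneGluing.SketchR2I5
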